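import Literature.AlgebraicGeometry.Motives.AbelianVarietyMirabolicGassmannPair
import HarnessLib

/-!
# The PARABOLIC GASSMANN PAIR in `GLₙ(𝔽_q)`: the stabiliser `Q₁` of a POINT of `ℙ^{n−1}` (a line `Fv₀`) and the
# stabiliser `Q₂` of a HYPERPLANE (a line `Fw₀` of covectors) have the same permutation character, for every `n`
# and every finite field, and are not conjugate for `n ≥ 3`; hence `B_{Q₁} ∼ B_{Q₂}` for every abelian variety with
# a `GLₙ(𝔽_q)`-action — Prasad's "`(G(𝔽_q), P_1(𝔽_q), P_2(𝔽_q))`" for `G = GLₙ`; ALGEBRAIC carrier, Hom counts over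
# an arbitrary field, isogeny and dimensions over a perfect field

Layer A1/A2 of the Hodge foundations lane (`lit-hodgefound`, row A1-20⁺ · A2, seat p03 generation 25, row g25-#10) on
the ALGEBRAIC carrier `AbelianVariety K` of `Motives/AbelianVariety`; sequel of
`Motives/AbelianVarietyMirabolicGassmannPair` (the VECTOR / COVECTOR stabilisers `P₁`, `P₂`; CONSUMED by name:
`natCard_fixedVec_ne_zero_eq` (`|{u ≠ 0 : Mu = u}| = |{w ≠ 0 : wM = w}|`), `exists_GL_mulVec_eq`,
`exists_GL_vecMul_eq` (transitivity), `natCard_mulVec_fiber_eq`, `natCard_vecMul_fiber_eq` (fibres are cosets),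
`natCard_vecStabilizer_eq` (`|P₁| = |P₂|`)), `Motives/AbelianVarietyBrauerRelationInflation` §3
(`isIsogenous_of_card_conj_mem_eq`, `card_isConj_eq_of_card_conj_mem_eq`) and
`Motives/AbelianVarietyBrauerRelationIsogenies` (`finrank_hom_image_eq_of_gassmann`).  "one good source of them is
`(G(𝔽_q), P_1(𝔽_q), P_2(𝔽_q))` where `G` is a reductive group over a finite field `𝔽_q`, with `P_1` and `P_2`
non-conjugate parabolic subgroups in `G` but for which their Levi subgroups are conjugate": for `G = GLₙ(𝔽_q)` the
maximal parabolics `Q₁ = Stab(Fv₀)` (a point of `ℙ^{n−1}`) and `Q₂ = Stab(Fw₀)` (a hyperplane).  The marks are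
`m_{Q₁}(g) = |P₁| · |{u ≠ 0 : gu ∈ Fu}|` and `m_{Q₂}(g) = |P₂| · |{w ≠ 0 : wg ∈ Fw}|` (fibres of `x ↦ xv₀`,
`x ↦ w₀x`), and sorting the `g`-stable lines by their eigenvalue `c ∈ F^×` reduces `|{u ≠ 0 : gu ∈ Fu}| =
|{w ≠ 0 : wg ∈ Fw}|` to the equality of the numbers of non-zero fixed vectors and fixed covectors of `c⁻¹g`
(§2 of the predecessor: `rank(M − 1) = rank((M − 1)ᵀ)`).  Everything is PROVED; the file introduces NO definition
and NO named fact (net Literature debt 0).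

## Sources, verbatim

D. Prasad, *A refined notion of arithmetically equivalent number fields, and curves with isomorphic Jacobians*,
Adv. Math. **312** (2017) 198–208 (arXiv 1409.3173, held text `paper:arxiv-1409.3173`), Introduction (p0002): "Call a
triple of finite groups `(G, H_1, H_2)` with `H_1` and `H_2` subgroups of `G`, a Gassmann triple, if `ℚ[G/H_1]` and
`ℚ[G/H_2]` are isomorphic as `G`-modules but `H_1` and `H_2` are not conjugate in `G`. Such examples exist in
abundance, and one good source of them is `(G(𝔽_q), P_1(𝔽_q), P_2(𝔽_q))` where `G` is a reductive group over a
finite field `𝔽_q`, with `P_1` and `P_2` non-conjugate parabolic subgroups in `G` but for which their Levi subgroups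
are conjugate; the smallest such example is therefore for `G = SL_3(𝔽_2)`, a simple group of order `168` containing
`P_1(𝔽_2)` and `P_2(𝔽_2)` as subgroups of index `7`."

D. Prasad, C. S. Rajan, *On an archimedean analogue of Tate's conjecture*, J. Number Theory **99** (2003),
arXiv:math/0203295 (held `paper:arxiv-math_0203295`), §2 ("`|C ∩ H_1| = |C ∩ H_2|` for all conjugacy classes
`C`"), Cor. 4.  V. Dokchitser, H. Green, A. Konstantinou, A. Morgan, arXiv 2211.06357, §1.3 Thm. 1.3 (= Kani–Rosen,
Math. Ann. 284 (1989), Thm. 3): "For every Brauer relation `Θ = Σ_i H_i − Σ_j H_j'` for `G`, there is an isogeny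
`∏_j Jac_{X/H_j'} → ∏_i Jac_{X/H_i}`" (here `Θ = Q₁ − Q₂`).

## Dictionary and what is proved

`F` a finite field, `n` a finite index type, `G = GLₙ(F) = GL n F`; `v₀, w₀ : n → F` non-zero;
`Q₁ = {A : ∃ c ≠ 0, Av₀ = c v₀}` (stabiliser of the point `[v₀] ∈ ℙ^{n−1}`), `Q₂ = {A : ∃ c ≠ 0, w₀A = c w₀}`
(stabiliser of the hyperplane `ker w₀`), by MEMBERSHIP CHARACTERISATIONS; `P₁ = Stab(v₀)`, `P₂ = Stab(w₀)` the
vector/covector stabilisers of the predecessor (any subgroups with those memberships; they exist: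
`MulAction.stabilizer`, `exists_subgroup_vecMul_eq`); marks `m_H(g) = |{x : x⁻¹gx ∈ H}|`.

* §1 `conj_mem_iff_line` (`x⁻¹gx ∈ Q₁ ↔ ∃ c ≠ 0, g(xv₀) = c·xv₀`), `mul_conj_mem_iff_hyperplane`,
  `exists_subgroup_mulVec_eq` / `exists_subgroup_vecMul_eq` (the vector and covector stabilisers as subgroups).
* §2 (eigen-lines) `natCard_eigvec_ne_zero_eq` (`|{u ≠ 0 : Mu = cu}| = |{w ≠ 0 : wM = cw}|`, `c ≠ 0`),
  `card_filter_stableLine_eq_sum` (sorting stable lines by eigenvalue: a disjoint union over `c ∈ F^×`),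
  **`natCard_stableVec_eq_natCard_stableCovec`** (`|{u ≠ 0 : gu ∈ F^×u}| = |{w ≠ 0 : wg ∈ F^×w}|`).
* §3 (marks) **`card_conj_mem_lineStabilizer`** (`m_{Q₁}(g) = |P₁| · |{u ≠ 0 : gu ∈ F^×u}|`),
  **`card_conj_mem_hyperplaneStabilizer`**, **`card_conj_mem_parabolic_eq`** (`m_{Q₁} = m_{Q₂}`: "`ℚ[G/H_1]` and
  `ℚ[G/H_2]` are isomorphic").
* §4 **`parabolic_not_conjugate`** (`|n| ≥ 3`: for every `x` some `h ∈ Q₁` has `xhx⁻¹ ∉ Q₂` — the transvection of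
  the predecessor moves the line `F·(w₀x)` of covectors).
* §5 (any field) **`finrank_hom_image_parabolicPair_eq`**; (perfect field) **`isIsogenous_parabolicPair`**
  (`B_{Q₁} ∼ B_{Q₂}`), **`dim_parabolicPair_eq`**.

Scope (stated, not hidden). (1) `GLₙ` (not `SLₙ`, `PGLₙ`); for `q = 2`, `Q_i = P_i` and the statement is that of the
predecessor / of `Motives/AbelianVarietyParabolicGassmannTriple`.  (2) Only the rational consequence (isogeny, Hom
counts, dimensions).  (3) Hom counts over ANY field; isogeny and dimensions over a PERFECT field.

## References

* [Prasad2017] D. Prasad, Adv. Math. 312 (2017) 198–208, arXiv:1409.3173, Introduction.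
* [PrasadRajan2003] D. Prasad, C. S. Rajan, J. Number Theory 99 (2003), arXiv:math/0203295, §2, Cor. 4.
* [KaniRosen1989] E. Kani, M. Rosen, Math. Ann. 284 (1989) 307–327, Thm. 3.
* [DokchitserEtAl2022] V. Dokchitser, H. Green, A. Konstantinou, A. Morgan, arXiv:2211.06357, §1.3 Thm. 1.3.
-/

noncomputable section

universe u

open CategoryTheory CategoryTheory.Limits Matrix

namespace Literature.AlgebraicGeometry.Motives

namespace MirabolicGassmann

/-! ## §1 Conjugation criteria for the line and hyperplane stabilisers; the auxiliary vector stabilisers -/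

section ParabolicCriteria

variable {F : Type} [Field F] {n : Type} [Fintype n] [DecidableEq n]

/-- **Conjugates in the line stabiliser**: if `A ∈ Q ↔ ∃ c ≠ 0, Av₀ = c v₀` then
`x⁻¹gx ∈ Q ↔ ∃ c ≠ 0, g(xv₀) = c·(xv₀)`. [cite: PrasadRajan2003, §2 (G-sets G/H)] [cite: Prasad2017, Introduction] -/
theorem conj_mem_iff_line (Q : Subgroup (GL n F)) (v₀ : n → F)
    (hQ : ∀ A : GL n F, A ∈ Q ↔ ∃ c : F, c ≠ 0 ∧ (A : Matrix n n F) *ᵥ v₀ = c • v₀) (g x : GL n F) :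
    x⁻¹ * g * x ∈ Q ↔
      ∃ c : F, c ≠ 0 ∧ (g : Matrix n n F) *ᵥ ((x : Matrix n n F) *ᵥ v₀) = c • ((x : Matrix n n F) *ᵥ v₀) := by
  rw [hQ]
  refine exists_congr fun c ↦ and_congr_right fun _ ↦ ?_
  rw [Matrix.GeneralLinearGroup.coe_mul, Matrix.GeneralLinearGroup.coe_mul, Matrix.mulVec_mulVec]
  constructor
  · intro h
    have h' := congrArg (fun w ↦ (x : Matrix n n F) *ᵥ w) h
    simp only [Matrix.mulVec_mulVec, ← mul_assoc, Units.mul_inv, one_mul, Matrix.mulVec_smul] at h'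
    exact h'
  · intro h
    have h' := congrArg (fun w ↦ ((x⁻¹ : GL n F) : Matrix n n F) *ᵥ w) h
    simp only [Matrix.mulVec_mulVec, ← mul_assoc, Units.inv_mul, Matrix.one_mulVec, Matrix.mulVec_smul] at h'
    exact h'

/-- **Conjugates in the hyperplane stabiliser**: if `A ∈ Q ↔ ∃ c ≠ 0, w₀A = c w₀` then
`xgx⁻¹ ∈ Q ↔ ∃ c ≠ 0, (w₀x)g = c·(w₀x)`. [cite: PrasadRajan2003, §2] [cite: Prasad2017, Introduction] -/
theorem mul_conj_mem_iff_hyperplane (Q : Subgroup (GL n F)) (w₀ : n → F)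
    (hQ : ∀ A : GL n F, A ∈ Q ↔ ∃ c : F, c ≠ 0 ∧ w₀ ᵥ* (A : Matrix n n F) = c • w₀) (g x : GL n F) :
    x * g * x⁻¹ ∈ Q ↔
      ∃ c : F, c ≠ 0 ∧ (w₀ ᵥ* (x : Matrix n n F)) ᵥ* (g : Matrix n n F) = c • (w₀ ᵥ* (x : Matrix n n F)) := by
  rw [hQ]
  refine exists_congr fun c ↦ and_congr_right fun _ ↦ ?_
  rw [Matrix.GeneralLinearGroup.coe_mul, Matrix.GeneralLinearGroup.coe_mul, Matrix.vecMul_vecMul]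
  constructor
  · intro h
    have h' := congrArg (fun w ↦ w ᵥ* (x : Matrix n n F)) h
    simp only [Matrix.vecMul_vecMul, mul_assoc, Units.inv_mul, mul_one, Matrix.smul_vecMul] at h'
    exact h'
  · intro h
    have h' := congrArg (fun w ↦ w ᵥ* ((x⁻¹ : GL n F) : Matrix n n F)) h
    simp only [Matrix.vecMul_vecMul, mul_assoc, Units.mul_inv, Matrix.vecMul_one, Matrix.smul_vecMul] at h'
    rw [← mul_assoc] at h'
    exact h'

/-- The vector stabiliser exists as a subgroup (Mathlib's `MulAction.stabilizer`, `A • v = A *ᵥ v`). [cite: Prasad2017, Introduction] -/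
theorem exists_subgroup_mulVec_eq (v₀ : n → F) :
    ∃ P : Subgroup (GL n F), ∀ A : GL n F, A ∈ P ↔ (A : Matrix n n F) *ᵥ v₀ = v₀ :=
  ⟨MulAction.stabilizer (GL n F) v₀, fun _ ↦ MulAction.mem_stabilizer_iff⟩

/-- The covector stabiliser exists as a subgroup. [cite: Prasad2017, Introduction] -/
theorem exists_subgroup_vecMul_eq (w₀ : n → F) :
    ∃ P : Subgroup (GL n F), ∀ A : GL n F, A ∈ P ↔ w₀ ᵥ* (A : Matrix n n F) = w₀ := by
  refine ⟨{ carrier := {A | w₀ ᵥ* (A : Matrix n n F) = w₀}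
            mul_mem' := fun {A B} hA hB ↦ ?_
            one_mem' := ?_
            inv_mem' := fun {A} hA ↦ ?_ }, fun A ↦ Iff.rfl⟩
  · simp only [Set.mem_setOf_eq] at hA hB ⊢
    rw [Matrix.GeneralLinearGroup.coe_mul, ← Matrix.vecMul_vecMul, hA, hB]
  · simp only [Set.mem_setOf_eq, Units.val_one, Matrix.vecMul_one]
  · simp only [Set.mem_setOf_eq] at hA ⊢
    have h := congrArg (fun w ↦ w ᵥ* ((A⁻¹ : GL n F) : Matrix n n F)) hA
    simp only [Matrix.vecMul_vecMul, Units.mul_inv, Matrix.vecMul_one] at h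
    exact h.symm

end ParabolicCriteria

/-! ## §2 Stable lines versus stable hyperplanes: sorting by the eigenvalue -/

section EigenLines

variable {F : Type} [Field F] [Fintype F] [DecidableEq F] {n : Type} [Fintype n] [DecidableEq n]

/-- **Eigenvectors versus eigen-covectors for a fixed eigenvalue `c ≠ 0`**:
`|{u ≠ 0 : Mu = cu}| = |{w ≠ 0 : wM = cw}|` (apply the fixed-vector count to `c⁻¹M`).
[cite: Prasad2017, Introduction] -/
theorem natCard_eigvec_ne_zero_eq (M : Matrix n n F) {c : F} (hc : c ≠ 0) :
    Nat.card {u : n → F // u ≠ 0 ∧ M *ᵥ u = c • u} = Nat.card {w : n → F // w ≠ 0 ∧ w ᵥ* M = c • w} := by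
  have h := natCard_fixedVec_ne_zero_eq (c⁻¹ • M)
  have e1 : Nat.card {u : n → F // u ≠ 0 ∧ (c⁻¹ • M) *ᵥ u = u} = Nat.card {u : n → F // u ≠ 0 ∧ M *ᵥ u = c • u} :=
    Nat.card_congr (Equiv.subtypeEquivRight fun u ↦ by rw [Matrix.smul_mulVec, inv_smul_eq_iff₀ hc])
  have e2 : Nat.card {w : n → F // w ≠ 0 ∧ w ᵥ* (c⁻¹ • M) = w} = Nat.card {w : n → F // w ≠ 0 ∧ w ᵥ* M = c • w} :=
    Nat.card_congr (Equiv.subtypeEquivRight fun w ↦ by rw [Matrix.vecMul_smul, inv_smul_eq_iff₀ hc])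
  rw [← e1, ← e2, h]

/-- Transfer of counts to decidable predicates. [folklore] -/
private theorem natCard_subtype_eq_card_filter {α : Type} [Fintype α] (P : α → Prop) [DecidablePred P]
    (Q : α → Prop) (hQP : ∀ x, Q x ↔ P x) : Nat.card {x : α // Q x} = (Finset.univ.filter P).card := by
  rw [← Fintype.card_subtype, ← Nat.card_eq_fintype_card]
  exact Nat.card_congr (Equiv.subtypeEquivRight hQP)

/-- **Sorting the `M`-stable lines by eigenvalue** (a disjoint union over `c ≠ 0`, since a non-zero vector has at
most one eigenvalue): `|{u ≠ 0 : ∃ c ≠ 0, Mu = cu}| = Σ_{c ≠ 0} |{u ≠ 0 : Mu = cu}|`. [cite: Prasad2017, Introduction] -/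
theorem natCard_stableVec_eq_sum (M : Matrix n n F) :
    Nat.card {u : n → F // u ≠ 0 ∧ ∃ c : F, c ≠ 0 ∧ M *ᵥ u = c • u} =
      ∑ c ∈ Finset.univ.filter (fun c : F ↦ c ≠ 0), Nat.card {u : n → F // u ≠ 0 ∧ M *ᵥ u = c • u} := by
  classical
  rw [natCard_subtype_eq_card_filter (fun u : n → F ↦ u ≠ 0 ∧ ∃ c : F, c ≠ 0 ∧ M *ᵥ u = c • u) _
    (fun _ ↦ Iff.rfl)]
  have hU : (Finset.univ.filter fun u : n → F ↦ u ≠ 0 ∧ ∃ c : F, c ≠ 0 ∧ M *ᵥ u = c • u) =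
      (Finset.univ.filter fun c : F ↦ c ≠ 0).biUnion
        fun c ↦ Finset.univ.filter fun u : n → F ↦ u ≠ 0 ∧ M *ᵥ u = c • u := by
    ext u
    simp only [Finset.mem_filter, Finset.mem_univ, true_and, Finset.mem_biUnion]
    exact ⟨fun ⟨hu, c, hc, h⟩ ↦ ⟨c, hc, hu, h⟩, fun ⟨c, hc, hu, h⟩ ↦ ⟨hu, c, hc, h⟩⟩
  rw [hU, Finset.card_biUnion]
  · exact Finset.sum_congr rfl fun c _ ↦
      (natCard_subtype_eq_card_filter (fun u : n → F ↦ u ≠ 0 ∧ M *ᵥ u = c • u) _ fun _ ↦ Iff.rfl).symm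
  · intro c _ c' _ hcc'
    refine Finset.disjoint_left.2 fun u hu hu' ↦ hcc' ?_
    simp only [Finset.mem_filter, Finset.mem_univ, true_and] at hu hu'
    have h : (c - c') • u = 0 := by rw [sub_smul, ← hu.2, ← hu'.2, sub_self]
    exact sub_eq_zero.1 ((smul_eq_zero.1 h).resolve_right hu.1)

/-- The same for covectors: `|{w ≠ 0 : ∃ c ≠ 0, wM = cw}| = Σ_{c ≠ 0} |{w ≠ 0 : wM = cw}|`. [cite: Prasad2017, Introduction] -/
theorem natCard_stableCovec_eq_sum (M : Matrix n n F) :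
    Nat.card {w : n → F // w ≠ 0 ∧ ∃ c : F, c ≠ 0 ∧ w ᵥ* M = c • w} =
      ∑ c ∈ Finset.univ.filter (fun c : F ↦ c ≠ 0), Nat.card {w : n → F // w ≠ 0 ∧ w ᵥ* M = c • w} := by
  classical
  rw [natCard_subtype_eq_card_filter (fun w : n → F ↦ w ≠ 0 ∧ ∃ c : F, c ≠ 0 ∧ w ᵥ* M = c • w) _
    (fun _ ↦ Iff.rfl)]
  have hU : (Finset.univ.filter fun w : n → F ↦ w ≠ 0 ∧ ∃ c : F, c ≠ 0 ∧ w ᵥ* M = c • w) =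
      (Finset.univ.filter fun c : F ↦ c ≠ 0).biUnion
        fun c ↦ Finset.univ.filter fun w : n → F ↦ w ≠ 0 ∧ w ᵥ* M = c • w := by
    ext w
    simp only [Finset.mem_filter, Finset.mem_univ, true_and, Finset.mem_biUnion]
    exact ⟨fun ⟨hw, c, hc, h⟩ ↦ ⟨c, hc, hw, h⟩, fun ⟨c, hc, hw, h⟩ ↦ ⟨hw, c, hc, h⟩⟩
  rw [hU, Finset.card_biUnion]
  · exact Finset.sum_congr rfl fun c _ ↦
      (natCard_subtype_eq_card_filter (fun w : n → F ↦ w ≠ 0 ∧ w ᵥ* M = c • w) _ fun _ ↦ Iff.rfl).symm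
  · intro c _ c' _ hcc'
    refine Finset.disjoint_left.2 fun w hw hw' ↦ hcc' ?_
    simp only [Finset.mem_filter, Finset.mem_univ, true_and] at hw hw'
    have h : (c - c') • w = 0 := by rw [sub_smul, ← hw.2, ← hw'.2, sub_self]
    exact sub_eq_zero.1 ((smul_eq_zero.1 h).resolve_right hw.1)

/-- **A matrix over a finite field stabilises as many lines as hyperplanes**:
`|{u ≠ 0 : gu ∈ F^×u}| = |{w ≠ 0 : wg ∈ F^×w}|` (termwise in the eigenvalue).
[cite: Prasad2017, Introduction ("ℚ[G/H_1] and ℚ[G/H_2] are isomorphic as G-modules")] -/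
theorem natCard_stableVec_eq_natCard_stableCovec (M : Matrix n n F) :
    Nat.card {u : n → F // u ≠ 0 ∧ ∃ c : F, c ≠ 0 ∧ M *ᵥ u = c • u} =
      Nat.card {w : n → F // w ≠ 0 ∧ ∃ c : F, c ≠ 0 ∧ w ᵥ* M = c • w} := by
  rw [natCard_stableVec_eq_sum, natCard_stableCovec_eq_sum]
  exact Finset.sum_congr rfl fun c hc ↦ natCard_eigvec_ne_zero_eq M (Finset.mem_filter.1 hc).2

end EigenLines

/-! ## §3 The marks of the line and hyperplane stabilisers -/

section ParabolicMarks

variable {F : Type} [Field F] [Fintype F] [DecidableEq F] {n : Type} [Fintype n] [DecidableEq n]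

/-- Counting through a map, fibre by fibre. [folklore] -/
private theorem natCard_comp_eq_sum {α β : Type} [Fintype α] [Fintype β] [DecidableEq β] (φ : α → β)
    (Q : β → Prop) [DecidablePred Q] :
    Nat.card {a : α // Q (φ a)} = ∑ b ∈ Finset.univ.filter Q, Nat.card {a : α // φ a = b} := by
  classical
  rw [natCard_subtype_eq_card_filter (fun a ↦ Q (φ a)) _ (fun _ ↦ Iff.rfl),
    Finset.card_eq_sum_card_fiberwise (f := φ) (s := Finset.univ.filter fun a ↦ Q (φ a))
      (t := Finset.univ.filter Q) fun a ha ↦ by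
        simp only [Finset.coe_filter, Finset.mem_univ, true_and, Set.mem_setOf_eq] at ha ⊢
        exact ha]
  refine Finset.sum_congr rfl fun b hb ↦ ?_
  have hb' : Q b := (Finset.mem_filter.1 hb).2
  rw [natCard_subtype_eq_card_filter (fun a ↦ φ a = b) _ (fun _ ↦ Iff.rfl)]
  congr 1
  ext a
  simp only [Finset.mem_filter, Finset.mem_univ, true_and]
  exact ⟨fun h ↦ h.2, fun h ↦ ⟨by rw [h]; exact hb', h⟩⟩

/-- **The marks of the line stabiliser**: for `v₀ ≠ 0`, `A ∈ Q₁ ↔ ∃ c ≠ 0, Av₀ = cv₀` and `P₁ = Stab(v₀)`,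
`m_{Q₁}(g) = |{x : x⁻¹gx ∈ Q₁}| = |P₁| · |{u ≠ 0 : gu ∈ F^×u}|` (sort the `x` by `u = xv₀`; each fibre is a coset of
`P₁`). [cite: PrasadRajan2003, §2] [cite: Prasad2017, Introduction] -/
theorem card_conj_mem_lineStabilizer (P₁ Q₁ : Subgroup (GL n F)) {v₀ : n → F} (hv₀ : v₀ ≠ 0)
    (hP₁ : ∀ A : GL n F, A ∈ P₁ ↔ (A : Matrix n n F) *ᵥ v₀ = v₀)
    (hQ₁ : ∀ A : GL n F, A ∈ Q₁ ↔ ∃ c : F, c ≠ 0 ∧ (A : Matrix n n F) *ᵥ v₀ = c • v₀) (g : GL n F) :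
    Nat.card {x : GL n F // x⁻¹ * g * x ∈ Q₁} =
      Nat.card P₁ * Nat.card {u : n → F // u ≠ 0 ∧ ∃ c : F, c ≠ 0 ∧ (g : Matrix n n F) *ᵥ u = c • u} := by
  classical
  calc Nat.card {x : GL n F // x⁻¹ * g * x ∈ Q₁}
      = Nat.card {x : GL n F // ∃ c : F, c ≠ 0 ∧
          (g : Matrix n n F) *ᵥ ((x : Matrix n n F) *ᵥ v₀) = c • ((x : Matrix n n F) *ᵥ v₀)} :=
        Nat.card_congr (Equiv.subtypeEquivRight (conj_mem_iff_line Q₁ v₀ hQ₁ g))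
    _ = ∑ u ∈ Finset.univ.filter (fun u : n → F ↦ ∃ c : F, c ≠ 0 ∧ (g : Matrix n n F) *ᵥ u = c • u),
          Nat.card {x : GL n F // (x : Matrix n n F) *ᵥ v₀ = u} :=
        natCard_comp_eq_sum (fun x : GL n F ↦ (x : Matrix n n F) *ᵥ v₀)
          (fun u ↦ ∃ c : F, c ≠ 0 ∧ (g : Matrix n n F) *ᵥ u = c • u)
    _ = ∑ u ∈ Finset.univ.filter (fun u : n → F ↦ ∃ c : F, c ≠ 0 ∧ (g : Matrix n n F) *ᵥ u = c • u),
          (if u = 0 then 0 else Nat.card P₁) := Finset.sum_congr rfl fun u _ ↦ by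
        split_ifs with hu
        · rw [hu, Nat.card_eq_zero]
          refine Or.inl ⟨fun x ↦ hv₀ ?_⟩
          have h := congrArg (fun w ↦ ((x.1⁻¹ : GL n F) : Matrix n n F) *ᵥ w) x.2
          simpa only [Matrix.mulVec_mulVec, Units.inv_mul, Matrix.one_mulVec, Matrix.mulVec_zero] using h
        · obtain ⟨x₀, hx₀⟩ := exists_GL_mulVec_eq hv₀ hu
          exact natCard_mulVec_fiber_eq P₁ hP₁ hx₀
    _ = Nat.card P₁ * ((Finset.univ.filter fun u : n → F ↦
          ∃ c : F, c ≠ 0 ∧ (g : Matrix n n F) *ᵥ u = c • u).filter fun u ↦ ¬u = 0).card := by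
        rw [Finset.sum_ite, Finset.sum_const_zero, zero_add, Finset.sum_const, smul_eq_mul, mul_comm]
    _ = Nat.card P₁ * Nat.card {u : n → F // u ≠ 0 ∧ ∃ c : F, c ≠ 0 ∧ (g : Matrix n n F) *ᵥ u = c • u} := by
        rw [Finset.filter_filter, natCard_subtype_eq_card_filter
          (fun u : n → F ↦ (∃ c : F, c ≠ 0 ∧ (g : Matrix n n F) *ᵥ u = c • u) ∧ ¬u = 0) _ (fun u ↦ and_comm)]

/-- **The marks of the hyperplane stabiliser**: for `w₀ ≠ 0`, `A ∈ Q₂ ↔ ∃ c ≠ 0, w₀A = cw₀` and `P₂ = Stab(w₀)`,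
`m_{Q₂}(g) = |{x : xgx⁻¹ ∈ Q₂}| = |P₂| · |{w ≠ 0 : wg ∈ F^×w}|`. [cite: PrasadRajan2003, §2] [cite: Prasad2017, Introduction] -/
theorem card_conj_mem_hyperplaneStabilizer (P₂ Q₂ : Subgroup (GL n F)) {w₀ : n → F} (hw₀ : w₀ ≠ 0)
    (hP₂ : ∀ A : GL n F, A ∈ P₂ ↔ w₀ ᵥ* (A : Matrix n n F) = w₀)
    (hQ₂ : ∀ A : GL n F, A ∈ Q₂ ↔ ∃ c : F, c ≠ 0 ∧ w₀ ᵥ* (A : Matrix n n F) = c • w₀) (g : GL n F) :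
    Nat.card {x : GL n F // x⁻¹ * g * x ∈ Q₂} =
      Nat.card P₂ * Nat.card {w : n → F // w ≠ 0 ∧ ∃ c : F, c ≠ 0 ∧ w ᵥ* (g : Matrix n n F) = c • w} := by
  classical
  calc Nat.card {x : GL n F // x⁻¹ * g * x ∈ Q₂}
      = Nat.card {x : GL n F // x * g * x⁻¹ ∈ Q₂} :=
        Nat.card_congr (Equiv.subtypeEquiv (Equiv.inv (GL n F)) fun x ↦ by rw [Equiv.inv_apply, inv_inv])
    _ = Nat.card {x : GL n F // ∃ c : F, c ≠ 0 ∧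
          (w₀ ᵥ* (x : Matrix n n F)) ᵥ* (g : Matrix n n F) = c • (w₀ ᵥ* (x : Matrix n n F))} :=
        Nat.card_congr (Equiv.subtypeEquivRight (mul_conj_mem_iff_hyperplane Q₂ w₀ hQ₂ g))
    _ = ∑ w ∈ Finset.univ.filter (fun w : n → F ↦ ∃ c : F, c ≠ 0 ∧ w ᵥ* (g : Matrix n n F) = c • w),
          Nat.card {x : GL n F // w₀ ᵥ* (x : Matrix n n F) = w} :=
        natCard_comp_eq_sum (fun x : GL n F ↦ w₀ ᵥ* (x : Matrix n n F))
          (fun w ↦ ∃ c : F, c ≠ 0 ∧ w ᵥ* (g : Matrix n n F) = c • w)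
    _ = ∑ w ∈ Finset.univ.filter (fun w : n → F ↦ ∃ c : F, c ≠ 0 ∧ w ᵥ* (g : Matrix n n F) = c • w),
          (if w = 0 then 0 else Nat.card P₂) := Finset.sum_congr rfl fun w _ ↦ by
        split_ifs with hw
        · rw [hw, Nat.card_eq_zero]
          refine Or.inl ⟨fun x ↦ hw₀ ?_⟩
          have h := congrArg (fun w ↦ w ᵥ* ((x.1⁻¹ : GL n F) : Matrix n n F)) x.2
          simpa only [Matrix.vecMul_vecMul, Units.mul_inv, Matrix.vecMul_one, Matrix.zero_vecMul] using h
        · obtain ⟨x₀, hx₀⟩ := exists_GL_vecMul_eq hw₀ hw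
          exact natCard_vecMul_fiber_eq P₂ hP₂ hx₀
    _ = Nat.card P₂ * ((Finset.univ.filter fun w : n → F ↦
          ∃ c : F, c ≠ 0 ∧ w ᵥ* (g : Matrix n n F) = c • w).filter fun w ↦ ¬w = 0).card := by
        rw [Finset.sum_ite, Finset.sum_const_zero, zero_add, Finset.sum_const, smul_eq_mul, mul_comm]
    _ = Nat.card P₂ * Nat.card {w : n → F // w ≠ 0 ∧ ∃ c : F, c ≠ 0 ∧ w ᵥ* (g : Matrix n n F) = c • w} := by
        rw [Finset.filter_filter, natCard_subtype_eq_card_filter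
          (fun w : n → F ↦ (∃ c : F, c ≠ 0 ∧ w ᵥ* (g : Matrix n n F) = c • w) ∧ ¬w = 0) _ (fun w ↦ and_comm)]

/-- **The parabolic Gassmann pair: equal marks.**  For `v₀, w₀ ≠ 0`, `Q₁ = Stab([v₀])`, `Q₂ = Stab(ker w₀)`:
`|{x : x⁻¹gx ∈ Q₁}| = |{x : x⁻¹gx ∈ Q₂}|` for every `g ∈ GLₙ(F)` — the permutation representations of `GLₙ(𝔽_q)` on
the points and on the hyperplanes of `ℙ^{n−1}(𝔽_q)` are isomorphic ("`(G(𝔽_q), P_1(𝔽_q), P_2(𝔽_q))`").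
[cite: Prasad2017, Introduction] [cite: PrasadRajan2003, §2] -/
theorem card_conj_mem_parabolic_eq (Q₁ Q₂ : Subgroup (GL n F)) {v₀ w₀ : n → F} (hv₀ : v₀ ≠ 0) (hw₀ : w₀ ≠ 0)
    (hQ₁ : ∀ A : GL n F, A ∈ Q₁ ↔ ∃ c : F, c ≠ 0 ∧ (A : Matrix n n F) *ᵥ v₀ = c • v₀)
    (hQ₂ : ∀ A : GL n F, A ∈ Q₂ ↔ ∃ c : F, c ≠ 0 ∧ w₀ ᵥ* (A : Matrix n n F) = c • w₀) (g : GL n F) :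
    Nat.card {x : GL n F // x⁻¹ * g * x ∈ Q₁} = Nat.card {x : GL n F // x⁻¹ * g * x ∈ Q₂} := by
  obtain ⟨P₁, hP₁⟩ := exists_subgroup_mulVec_eq (F := F) v₀
  obtain ⟨P₂, hP₂⟩ := exists_subgroup_vecMul_eq (F := F) w₀
  rw [card_conj_mem_lineStabilizer P₁ Q₁ hv₀ hP₁ hQ₁, card_conj_mem_hyperplaneStabilizer P₂ Q₂ hw₀ hP₂ hQ₂,
    natCard_vecStabilizer_eq P₁ P₂ hv₀ hw₀ hP₁ hP₂, natCard_stableVec_eq_natCard_stableCovec]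

end ParabolicMarks

/-! ## §4 Non-conjugacy for `n ≥ 3` -/

section ParabolicNotConjugate

variable {F : Type} [Field F] {n : Type} [Fintype n] [DecidableEq n]

omit [DecidableEq n] in
/-- The transvection data: for `n ≥ 3`, a non-zero `b` with `bᵀv₀ = 0` and `bᵀa = 0`. [folklore] -/
private theorem exists_ne_zero_dotProduct_eq_zero' (hn : 3 ≤ Fintype.card n) (v₀ a : n → F) :
    ∃ b : n → F, b ≠ 0 ∧ b ⬝ᵥ v₀ = 0 ∧ b ⬝ᵥ a = 0 := by
  let f : (n → F) →ₗ[F] F × F :=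
    { toFun := fun b ↦ (b ⬝ᵥ v₀, b ⬝ᵥ a)
      map_add' := fun b c ↦ by simp only [add_dotProduct, Prod.mk_add_mk]
      map_smul' := fun c b ↦ by simp only [smul_dotProduct, RingHom.id_apply, Prod.smul_mk] }
  have hker : 0 < Module.finrank F (LinearMap.ker f) := by
    have h := LinearMap.finrank_range_add_finrank_ker f
    rw [Module.finrank_fintype_fun_eq_card] at h
    have hr : Module.finrank F (LinearMap.range f) ≤ 2 := by
      calc Module.finrank F (LinearMap.range f) ≤ Module.finrank F (F × F) := Submodule.finrank_le _
        _ = 2 := by rw [Module.finrank_prod, Module.finrank_self]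
    omega
  obtain ⟨⟨b, hb⟩, hne⟩ := (Module.finrank_pos_iff_exists_ne_zero (R := F) (M := LinearMap.ker f)).1 hker
  have hb0 : b ≠ 0 := fun h0 ↦ hne (Subtype.ext h0)
  rw [LinearMap.mem_ker] at hb
  exact ⟨b, hb0, (Prod.mk.inj hb).1, (Prod.mk.inj hb).2⟩

/-- **`Q₁` and `Q₂` are not conjugate (`n ≥ 3`)**: for every `x` some `h ∈ Q₁` (indeed `hv₀ = v₀`) has
`xhx⁻¹ ∉ Q₂` — the transvection `h = 1 + abᵀ` (`bᵀv₀ = bᵀa = 0`, `b ≠ 0`, `(w₀x)a ≠ 0`) fixes `v₀` but does not map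
the covector `w₀x` to a multiple of itself. [cite: Prasad2017, Introduction ("P_1 and P_2 non-conjugate")] -/
theorem parabolic_not_conjugate (hn : 3 ≤ Fintype.card n) (Q₁ Q₂ : Subgroup (GL n F)) {v₀ w₀ : n → F}
    (hw₀ : w₀ ≠ 0) (hQ₁ : ∀ A : GL n F, A ∈ Q₁ ↔ ∃ c : F, c ≠ 0 ∧ (A : Matrix n n F) *ᵥ v₀ = c • v₀)
    (hQ₂ : ∀ A : GL n F, A ∈ Q₂ ↔ ∃ c : F, c ≠ 0 ∧ w₀ ᵥ* (A : Matrix n n F) = c • w₀) (x : GL n F) :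
    ∃ h ∈ Q₁, x * h * x⁻¹ ∉ Q₂ := by
  have hw : w₀ ᵥ* (x : Matrix n n F) ≠ 0 := by
    intro h0
    have h1 := congrArg (fun w ↦ w ᵥ* ((x⁻¹ : GL n F) : Matrix n n F)) h0
    simp only [Matrix.vecMul_vecMul, Units.mul_inv, Matrix.vecMul_one, Matrix.zero_vecMul] at h1
    exact hw₀ h1
  obtain ⟨j, hj⟩ := Function.ne_iff.1 hw
  obtain ⟨b, hb0, hbv, hba⟩ := exists_ne_zero_dotProduct_eq_zero' hn v₀ (Pi.single j (1 : F))
  have hdet : (1 + Matrix.vecMulVec (Pi.single j (1 : F)) b).det ≠ 0 := by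
    rw [Matrix.vecMulVec_eq Unit, Matrix.det_one_add_replicateCol_mul_replicateRow, hba, add_zero]
    exact one_ne_zero
  refine ⟨Matrix.GeneralLinearGroup.mkOfDetNeZero _ hdet, (hQ₁ _).2 ⟨1, one_ne_zero, ?_⟩, fun hmem ↦ ?_⟩
  · change (1 + Matrix.vecMulVec (Pi.single j (1 : F)) b) *ᵥ v₀ = (1 : F) • v₀
    rw [Matrix.add_mulVec, Matrix.one_mulVec, Matrix.vecMulVec_mulVec, hbv, MulOpposite.op_zero, zero_smul,
      add_zero, one_smul]
  · obtain ⟨c, hc, h⟩ := (mul_conj_mem_iff_hyperplane Q₂ w₀ hQ₂ _ x).1 hmem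
    change (w₀ ᵥ* (x : Matrix n n F)) ᵥ* (1 + Matrix.vecMulVec (Pi.single j (1 : F)) b) =
      c • (w₀ ᵥ* (x : Matrix n n F)) at h
    rw [Matrix.vecMul_add, Matrix.vecMul_one, Matrix.vecMul_vecMulVec, dotProduct_single, mul_one] at h
    -- `w + w_j • b = c • w` with `w_j ≠ 0`, `b ≠ 0`, `b_j = bᵀe_j = 0`: read off the `j`-th coordinate
    have hbj : b j = 0 := by simpa only [dotProduct_single, mul_one] using hba
    have h' := congrFun h j
    simp only [Pi.add_apply, Pi.smul_apply, smul_eq_mul, hbj, mul_zero, add_zero] at h'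
    -- h' : w_j = c * w_j, so c = 1
    have hc1 : c = 1 := by
      have : (c - 1) * (w₀ ᵥ* (x : Matrix n n F)) j = 0 := by rw [sub_mul, one_mul, ← h', sub_self]
      exact sub_eq_zero.1 ((mul_eq_zero.1 this).resolve_right hj)
    rw [hc1, one_smul, add_eq_left, smul_eq_zero] at h
    exact h.elim hj hb0

end ParabolicNotConjugate

end MirabolicGassmann

namespace AbelianVariety

/-! ## §5 `B_{Q₁} ∼ B_{Q₂}` for every abelian variety with a `GLₙ(𝔽_q)`-action -/

section ParabolicGassmannPairAV

open MirabolicGassmann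

variable {K : Type u} [Field K] {X : AbelianVariety K} {F : Type} [Field F] [Fintype F] [DecidableEq F]
  {n : Type} [Fintype n] [DecidableEq n] (ρ : GL n F →* End X) (Q₁ Q₂ : Subgroup (GL n F))
  [Fintype Q₁] [Fintype Q₂] {v₀ w₀ : n → F} {N₁ N₂ : X ⟶ X}

/-- **Equal Hom counts for the parabolic pair** (any field): for an action of `GLₙ(𝔽_q)` on `X`, the stabiliser `Q₁`
of the point `[v₀]` (`A ∈ Q₁ ↔ ∃ c ≠ 0, Av₀ = cv₀`), the stabiliser `Q₂` of the hyperplane `ker w₀`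
(`A ∈ Q₂ ↔ ∃ c ≠ 0, w₀A = cw₀`), `v₀, w₀ ≠ 0`, and every `B`: **`rk Hom(B_{Q₁}, B) = rk Hom(B_{Q₂}, B)`**.
[cite: Prasad2017, Introduction] [cite: PrasadRajan2003, Cor. 4] [cite: KaniRosen1989, Thm. 3] -/
theorem finrank_hom_image_parabolicPair_eq (hv₀ : v₀ ≠ 0) (hw₀ : w₀ ≠ 0)
    (hQ₁ : ∀ A : GL n F, A ∈ Q₁ ↔ ∃ c : F, c ≠ 0 ∧ (A : Matrix n n F) *ᵥ v₀ = c • v₀)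
    (hQ₂ : ∀ A : GL n F, A ∈ Q₂ ↔ ∃ c : F, c ≠ 0 ∧ w₀ ᵥ* (A : Matrix n n F) = c • w₀)
    (hN₁ : End.of N₁ = ∑ h : Q₁, ρ h) (hN₂ : End.of N₂ = ∑ h : Q₂, ρ h) (B : AbelianVariety K) :
    Module.finrank ℤ (image N₁ ⟶ B) = Module.finrank ℤ (image N₂ ⟶ B) :=
  finrank_hom_image_eq_of_gassmann ρ Q₁ Q₂
    (card_isConj_eq_of_card_conj_mem_eq Q₁ Q₂ (card_conj_mem_parabolic_eq Q₁ Q₂ hv₀ hw₀ hQ₁ hQ₂)) hN₁ hN₂ B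

variable [PerfectField K]

/-- **The parabolic Gassmann pair gives isogenous `B`'s** (perfect field): **`B_{Q₁} ∼ B_{Q₂}`** for every abelian
variety with a `GLₙ(𝔽_q)`-action — `Q₁` the stabiliser of a point, `Q₂` of a hyperplane of `ℙ^{n−1}(𝔽_q)`, not
conjugate for `n ≥ 3` (`MirabolicGassmann.parabolic_not_conjugate`): the isogeny relation of the Brauer relation
`Q₁ − Q₂` of "`(G(𝔽_q), P_1(𝔽_q), P_2(𝔽_q))`". [cite: Prasad2017, Introduction] [cite: PrasadRajan2003, Cor. 4]
[cite: KaniRosen1989, Thm. 3] [cite: DokchitserEtAl2022, §1.3 Thm. 1.3] -/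
theorem isIsogenous_parabolicPair (hv₀ : v₀ ≠ 0) (hw₀ : w₀ ≠ 0)
    (hQ₁ : ∀ A : GL n F, A ∈ Q₁ ↔ ∃ c : F, c ≠ 0 ∧ (A : Matrix n n F) *ᵥ v₀ = c • v₀)
    (hQ₂ : ∀ A : GL n F, A ∈ Q₂ ↔ ∃ c : F, c ≠ 0 ∧ w₀ ᵥ* (A : Matrix n n F) = c • w₀)
    (hN₁ : End.of N₁ = ∑ h : Q₁, ρ h) (hN₂ : End.of N₂ = ∑ h : Q₂, ρ h) : IsIsogenous (image N₁) (image N₂) :=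
  isIsogenous_of_card_conj_mem_eq ρ Q₁ Q₂ (card_conj_mem_parabolic_eq Q₁ Q₂ hv₀ hw₀ hQ₁ hQ₂) hN₁ hN₂

/-- **Dimensions: `dim B_{Q₁} = dim B_{Q₂}`** (perfect field; for Jacobians `g(C̃/Q₁) = g(C̃/Q₂)`).
[cite: Prasad2017, Introduction] [cite: PrasadRajan2003, Cor. 4] -/
theorem dim_parabolicPair_eq (hv₀ : v₀ ≠ 0) (hw₀ : w₀ ≠ 0)
    (hQ₁ : ∀ A : GL n F, A ∈ Q₁ ↔ ∃ c : F, c ≠ 0 ∧ (A : Matrix n n F) *ᵥ v₀ = c • v₀)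
    (hQ₂ : ∀ A : GL n F, A ∈ Q₂ ↔ ∃ c : F, c ≠ 0 ∧ w₀ ᵥ* (A : Matrix n n F) = c • w₀)
    (hN₁ : End.of N₁ = ∑ h : Q₁, ρ h) (hN₂ : End.of N₂ = ∑ h : Q₂, ρ h) : (image N₁).dim = (image N₂).dim :=
  (isIsogenous_parabolicPair ρ Q₁ Q₂ hv₀ hw₀ hQ₁ hQ₂ hN₁ hN₂).dim_eq

end ParabolicGassmannPairAV

end AbelianVariety

end Literature.AlgebraicGeometry.Motives
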